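import Literature.Computability.Cryptography.LWEBinaryHybrids
import HarnessLib

/-!
# The leftover-hash term of BLPRS 2013, Lemma 4.9: `Δ((C, Cz); U) ≤ ε` for a uniform binary `z` (bridge to Lemma 2.2)

Topic `Computability/Cryptography` (LWE), grouping namespace `LWE`; sequel of `LWEBinaryHybrids.lean`
(Lemma 4.9's hybrid chain, whose `H₂`-versus-`H₃` term is `(lawCz k ζ).tvDist U`, the statistical distance
between the law of `(C, C z̄)` for `C ← U(ℤ_q^{k×n})`, `z ← ζ` and the uniform law) and of
`LeftoverHashUniversal.lean` (BLPRS Lemma 2.2, `LeftoverHash.blprs_lemma_2_2`, stated with the finset-level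
`LeftoverHash.distUnif` of the keyed map `(H, z) ↦ (H, Hz)` on the flat source `ℤ_q^{k×n} × {0,1}ⁿ`).
Proved glue (no named fact) towards pqc.S21:

> *"… `|Pr[𝒜(H₂)] - Pr[𝒜(H₃)]| ≤ δ` by the leftover hash lemma (see Lemma 2.2), since `H₂, H₃` can be
> derived from `(C, qC·z)` and `(C, s)` respectively, whose statistical distance is at most `δ`."*
> (arXiv:1306.0281, proof of Lemma 4.9) — with Lemma 2.2: for `n ≥ k log₂ q + 2 log₂(1/δ)` and
> `z ← {0,1}ⁿ`, `Δ((C, Cz); (C, s)) ≤ δ`.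

## Results

* `toReal_uniformOfFinset_map_apply`, **`tvDist_uniformOfFinset_map_eq_distUnif`** — generic bridge:
  for a flat source `S` and any map `g` into a finite type, the tree's `PMF.tvDist` between `g(U_S)` and
  the uniform law IS `LeftoverHash.distUnif S g univ`;
* `uniformOfFinset_product` — the flat source on `s ×ˢ t` is the independent pair of the flat sources;
* `binaryIntLaw q n` — the uniform law on `{0,1}ⁿ ⊆ ℤⁿ` (realised as the `ℤ`-lift of the tree's flat
  source `{0,1}ⁿ ⊆ ℤ_qⁿ`), with `binaryIntLaw_map_intCastVec : … = binarySecretLaw n q` (so `hybridH₁` at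
  `ζ = binaryIntLaw q n` is `binLWE` with the secret-dependent noise `noiseH₁`, `hybridH₁_binaryIntLaw`) and
  `lawCz_binaryIntLaw` (the law of `(C, C z̄)` is the keyed flat source of Lemma 2.2);
* **`tvDist_lawCz_binaryIntLaw_le`** — for `q ≥ 2`, `0 < ε`, `k log₂ q + 2 log₂(1/ε) ≤ n`:
  `Δ((C, C z̄); U) ≤ ε`, the `δ` of Lemma 4.9.

## References

* Z. Brakerski, A. Langlois, C. Peikert, O. Regev, D. Stehlé, *Classical hardness of learning with errors*,
  STOC 2013; arXiv:1306.0281, Lemma 2.2 and the proof of Lemma 4.9 (`H₂` vs `H₃`).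
-/

noncomputable section

open scoped ENNReal
open Matrix Finset Literature.Probability.Distributions

namespace Literature.Computability.Cryptography

namespace LWE

/-! ### Generic bridge: `PMF.tvDist` of a pushed-forward flat source versus `LeftoverHash.distUnif` -/

section Bridge

variable {ι β : Type} [DecidableEq β]

/-- Mass of the push-forward of a flat source: `Pr[g(U_S) = b] = |fibre| / |S| = LeftoverHash.prob S g b`.
[folklore] -/
theorem toReal_uniformOfFinset_map_apply (S : Finset ι) (hS : S.Nonempty) (g : ι → β) (b : β) :
    (((PMF.uniformOfFinset S hS).map g) b).toReal = LeftoverHash.prob S g b := by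
  classical
  rw [← PMF.toOuterMeasure_apply_singleton, PMF.toOuterMeasure_map_apply,
    PMF.toOuterMeasure_uniformOfFinset_apply, LeftoverHash.prob, LeftoverHash.fib, ENNReal.toReal_div,
    ENNReal.toReal_natCast, ENNReal.toReal_natCast]
  congr 3
  exact Finset.filter_congr fun x _ => by simp

/-- **Bridge**: for a flat source `S`, a map `g` into a finite type and the uniform reference law, the
tree's statistical distance `PMF.tvDist (g(U_S)) U` equals `LeftoverHash.distUnif S g univ`. [folklore] -/
theorem tvDist_uniformOfFinset_map_eq_distUnif [Fintype β] [Nonempty β] (S : Finset ι) (hS : S.Nonempty)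
    (g : ι → β) :
    ((PMF.uniformOfFinset S hS).map g).tvDist (PMF.uniformOfFintype β) = LeftoverHash.distUnif S g Finset.univ := by
  rw [PMF.tvDist, LeftoverHash.distUnif, tsum_fintype]
  congr 1
  refine Finset.sum_congr rfl fun b _ => ?_
  rw [toReal_uniformOfFinset_map_apply, PMF.uniformOfFintype_apply, ENNReal.toReal_inv,
    ENNReal.toReal_natCast, Finset.card_univ, one_div]

omit [DecidableEq β] in
/-- **A flat source on a product finset is the independent pair of the flat sources.** [folklore] -/
theorem uniformOfFinset_product (s : Finset ι) (t : Finset β) (hs : s.Nonempty) (ht : t.Nonempty) :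
    PMF.uniformOfFinset (s ×ˢ t) (hs.product ht) = prodLaw (PMF.uniformOfFinset s hs) (PMF.uniformOfFinset t ht) := by
  classical
  refine PMF.ext fun p => ?_
  rw [prodLaw_apply', PMF.uniformOfFinset_apply, PMF.uniformOfFinset_apply, PMF.uniformOfFinset_apply]
  have hs0 : ((s.card : ℕ) : ℝ≥0∞) ≠ 0 := by exact_mod_cast hs.card_pos.ne'
  by_cases h1 : p.1 ∈ s <;> by_cases h2 : p.2 ∈ t <;>
    simp [Finset.mem_product, Finset.card_product, h1, h2,
      ENNReal.mul_inv (Or.inl hs0) (Or.inl (ENNReal.natCast_ne_top _))]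

end Bridge

/-! ### The uniform binary secret as an integer vector, and the law of `(C, C z̄)` -/

section Binary

variable (q : ℕ) [NeZero q] (n : ℕ) {k : ℕ}

/-- The uniform law on `{0,1}ⁿ ⊆ ℤⁿ`, realised as the `ℤ`-lift (`val`) of the tree's flat source
`{0,1}ⁿ ⊆ ℤ_qⁿ` (`LeftoverHash.binVecs_nonempty`); for `q ≥ 2` this is the uniform distribution on the
`2ⁿ` binary integer vectors. [cite: BrakerskiEtAl2013, Def. 2.11 (binLWE) and Lemma 4.9] -/
def binaryIntLaw : PMF (Fin n → ℤ) :=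
  (PMF.uniformOfFinset (Finset.univ.filter fun z : Fin n → ZMod q => ∀ j, z j = 0 ∨ z j = 1)
      LeftoverHash.binVecs_nonempty).map fun z j => ((z j).val : ℤ)

variable {q n}

/-- Lifting to `ℤ` and reading back in `ℤ_q` is the identity. [folklore] -/
theorem intCastVec_val (z : Fin n → ZMod q) : (intCastVec (fun j => ((z j).val : ℤ)) : Fin n → ZMod q) = z := by
  funext j
  simp [intCastVec]

/-- Read in `ℤ_q`, `binaryIntLaw` is the tree's `binarySecretLaw`. [cite: BrakerskiEtAl2013, Def. 2.11 (binLWE)] -/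
theorem binaryIntLaw_map_intCastVec :
    (binaryIntLaw q n).map (intCastVec (R := ZMod q)) = binarySecretLaw n q := by
  rw [binaryIntLaw, PMF.map_comp, binarySecretLaw]
  convert PMF.map_id _ using 2
  funext z
  exact intCastVec_val z

/-- **`H₁` at the uniform binary secret is `binLWE` with the secret-dependent noise `noiseH₁`.**
[cite: BrakerskiEtAl2013, Lemma 4.9 (proof, hybrid H₁)] -/
theorem hybridH₁_binaryIntLaw (χN : PMF (Fin n → ℤ)) (χh : PMF (ZMod q)) (m : ℕ) :
    hybridH₁ χN χh m (binaryIntLaw q n) = lweSamplesSecretNoiseLaw (noiseH₁ χN χh) (binarySecretLaw n q) m := by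
  rw [hybridH₁_eq, binaryIntLaw_map_intCastVec]

/-- **The law of `(C, C z̄)` for `z ← {0,1}ⁿ` is the keyed flat source of Lemma 2.2**: the push-forward of
the uniform law on `ℤ_q^{k×n} × {0,1}ⁿ` along `(H, z) ↦ (H, Hz)`. [cite: BrakerskiEtAl2013, Lemma 4.9 (proof: "derived from (C, qCz)")] -/
theorem lawCz_binaryIntLaw :
    (lawCz k (binaryIntLaw q n) : PMF (Matrix (Fin k) (Fin n) (ZMod q) × (Fin k → ZMod q))) =
      (PMF.uniformOfFinset ((Finset.univ : Finset (Matrix (Fin k) (Fin n) (ZMod q))) ×ˢ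
          (Finset.univ.filter fun z : Fin n → ZMod q => ∀ j, z j = 0 ∨ z j = 1))
          (Finset.univ_nonempty.product LeftoverHash.binVecs_nonempty)).map
        (LeftoverHash.keyed fun (H : Matrix (Fin k) (Fin n) (ZMod q)) (z : Fin n → ZMod q) => H *ᵥ z) := by
  rw [uniformOfFinset_product _ _ Finset.univ_nonempty LeftoverHash.binVecs_nonempty,
    show PMF.uniformOfFinset (Finset.univ : Finset (Matrix (Fin k) (Fin n) (ZMod q))) Finset.univ_nonempty =
      PMF.uniformOfFintype _ from rfl,
    prodLaw, PMF.map_bind, lawCz, binaryIntLaw, PMF.bind_map]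
  -- LHS: `binVecs ≫= (z ↦ U(C).map (C ↦ (C, C z̄)))`; RHS: `U(C) ≫= (C ↦ (binVecs.map (C, ·)).map keyed)`
  simp only [Function.comp_def, LeftoverHash.keyed, intCastVec_val, map_eq_bind_pure', PMF.bind_bind,
    PMF.pure_bind]
  rw [PMF.bind_comm]


/-- **The `δ` of Lemma 4.9**: for `q ≥ 2`, `0 < ε` and `k log₂ q + 2 log₂(1/ε) ≤ n`, the law of `(C, C z̄)`
(`C ← U(ℤ_q^{k×n})`, `z ← {0,1}ⁿ`) is within statistical distance `ε` of uniform — BLPRS Lemma 2.2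
(`LeftoverHash.blprs_lemma_2_2`) through the bridge. [cite: BrakerskiEtAl2013, Lemma 2.2 and Lemma 4.9 (proof)] -/
theorem tvDist_lawCz_binaryIntLaw_le (hq : 1 < q) {ε : ℝ} (hε : 0 < ε)
    (hn : (k : ℝ) * Real.logb 2 q + 2 * Real.logb 2 (1 / ε) ≤ n) :
    (lawCz k (binaryIntLaw q n) : PMF (Matrix (Fin k) (Fin n) (ZMod q) × (Fin k → ZMod q))).tvDist
        (PMF.uniformOfFintype _) ≤ ε := by
  rw [lawCz_binaryIntLaw, tvDist_uniformOfFinset_map_eq_distUnif]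
  have h := LeftoverHash.blprs_lemma_2_2 (k := k) (n := n) hq hε hn
  rw [Finset.univ_product_univ] at h
  convert h using 2

end Binary

end LWE

end Literature.Computability.Cryptography

end
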